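import Summits.RiemannHypothesis.RiemannHypothesis.Theorems.TiltedLandingLaw421R3Lens1ToothLiftSplit

/-!
# TiltedLandingLaw421R3 — lens-1: «CritMargin» — the critical-point identity and the termwise signs of the nesting margin (K only)

LENS-1 gen-10 image candidate ((CA1123)(3); landing target `…/Theorems/TiltedLandingLaw421R3Lens1CritMargin.lean`; single TREE import = #1300
`…R3Lens1ToothLiftSplit`; namespace `RhW08.Lens1CritMargin`; 0 `sorry`, no instances / notation / set_option).  Pure algebra over `ℂ`; no function
theory, no frame.  WORDS: `G1W-SKELETON-WORDS-v1.md` 62e8ccff §2.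

(i) THE CRITICAL-POINT IDENTITY.  If `φ(w) = g + (w − T)⁻¹ + S = 0` with `g` real (the tilt) and `S` = the rest of the logarithmic derivative AT `w`,
then `w − T = −(g + S)⁻¹` and `(Re w − Re T)² + (Im w)² − (Im T)² = (1 + 2·Im T·Im S)/‖g + S‖²` — the tilt drops out of the numerator; hence
`NestedStep T w ↔ 1 + 2·Im T·Im S ≤ 0` (`nestedStep_iff_of_crit`).
(ii) THE TERMWISE SIGNS of the margin `M_T = −2R·Im S(T) − 1` (`R = Im T`), with `nestMarginTerm T z := −2R·Im (T − z)⁻¹ = 2R(R − Im z)/‖T − z‖²`: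
`T̄ ↦ 1` exactly (`nestMarginTerm_conj_self`); every zero at height `≤ R` (companions' first term, real zeros, lower pairs, every conjugate) `↦ ≥ 0`
(`nestMarginTerm_nonneg_of_im_le`); a companion's conjugate `q̄ ↦ ≥ 1` IFF `q` lies in `T`'s CLOSED Jensen disc, `= 1` on the arc
(`one_le_nestMarginTerm_conj_iff`);
a TALLER pair `{b, b̄}` `↦ ≥ 0` as soon as `(Re b − Re T)² ≥ (Im b)² − R²`, in particular under `NoTallerToucher`'s `R + Im b < |Re T − Re b|`
(`nestMarginTerm_pair_nonneg_of_sq_le`, `nestMarginTerm_pair_nonneg_of_noTaller`).  So on L_comp `M_T ≥ #companions`, on L_iso `M_T ≥ 0`.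

HONEST LABEL: identities and inequalities about points of `ℂ`; they assert nothing about any `f`; engines (A)/(B) of the words are NOT typed here;
(G1)/(G2)/(G3), (ii″)/(iii″), `TopPinning`, 33346, 33347 OPEN; nothing here bears on the truth of RH; RH is not proved.
-/

noncomputable section

namespace RhW08.Lens1CritMargin

open Complex
open scoped ComplexConjugate
open RhW08.QuadW (NestedStep)

/-! ## §1 The critical-point identity -/

/-- From `φ(w) = 0`: the step `w − T` is minus the inverse of the REST of the field (`g + S`), which is therefore non-zero. -/
theorem crit_sub_eq {T w S : ℂ} {g : ℝ} (hw : w ≠ T) (h : (g : ℂ) + (w - T)⁻¹ + S = 0) :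
    (g : ℂ) + S ≠ 0 ∧ w - T = -((g : ℂ) + S)⁻¹ := by
  have hwT : w - T ≠ 0 := sub_ne_zero.2 hw
  have hA : (g : ℂ) + S = -(w - T)⁻¹ := by linear_combination h
  refine ⟨?_, ?_⟩
  · rw [hA, neg_ne_zero]; exact inv_ne_zero hwT
  · rw [hA, inv_neg, inv_inv, neg_neg]

/-- ★ THE CRITICAL-POINT IDENTITY: `(Re w − Re T)² + (Im w)² − (Im T)² = (1 + 2·Im T·Im S)/‖g + S‖²` (tilt-free numerator). -/
theorem crit_identity {T w S : ℂ} {g : ℝ} (hw : w ≠ T) (h : (g : ℂ) + (w - T)⁻¹ + S = 0) :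
    (w.re - T.re) ^ 2 + w.im ^ 2 - T.im ^ 2 = (1 + 2 * T.im * S.im) / Complex.normSq ((g : ℂ) + S) := by
  obtain ⟨hA, hwT⟩ := crit_sub_eq hw h
  set A : ℂ := (g : ℂ) + S with hAdef
  have hn : Complex.normSq A ≠ 0 := (Complex.normSq_pos.2 hA).ne'
  have hre : w.re - T.re = -(A.re / Complex.normSq A) := by
    have := congrArg Complex.re hwT; rw [Complex.sub_re] at this; rw [this, Complex.neg_re, Complex.inv_re]
  have him : w.im = T.im + A.im / Complex.normSq A := by
    have := congrArg Complex.im hwT; rw [Complex.sub_im] at this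
    rw [Complex.neg_im, Complex.inv_im, neg_div, neg_neg] at this; linarith
  have hAim : A.im = S.im := by rw [hAdef, Complex.add_im, Complex.ofReal_im, zero_add]
  have hkey : A.re ^ 2 + A.im ^ 2 = Complex.normSq A := by rw [Complex.normSq_apply]; ring
  rw [← hAim, show (w.re - T.re) ^ 2 + w.im ^ 2 - T.im ^ 2 = (A.re ^ 2 + A.im ^ 2) / Complex.normSq A ^ 2 + 2 * T.im * A.im / Complex.normSq A by
    rw [hre, him]; field_simp; ring, hkey]
  field_simp

/-- ★ NESTING CRITERION at a critical point: `NestedStep T w ↔ 1 + 2·Im T·Im S ≤ 0`. -/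
theorem nestedStep_iff_of_crit {T w S : ℂ} {g : ℝ} (hw : w ≠ T) (h : (g : ℂ) + (w - T)⁻¹ + S = 0) :
    NestedStep T w ↔ 1 + 2 * T.im * S.im ≤ 0 := by
  obtain ⟨hA, -⟩ := crit_sub_eq hw h
  have hn : 0 < Complex.normSq ((g : ℂ) + S) := Complex.normSq_pos.2 hA
  have hid := crit_identity hw h
  unfold NestedStep
  constructor
  · intro hN
    have h1 : (1 + 2 * T.im * S.im) / Complex.normSq ((g : ℂ) + S) ≤ 0 := by rw [← hid]; linarith
    by_contra hc
    exact absurd h1 (not_le.2 (div_pos (not_le.1 hc) hn))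
  · intro hM
    have h1 : (1 + 2 * T.im * S.im) / Complex.normSq ((g : ℂ) + S) ≤ 0 := div_nonpos_of_nonpos_of_nonneg hM hn.le
    linarith [hid]

/-! ## §2 The termwise signs of the margin `M_T = −2R·Im S(T) − 1` -/

/-- The contribution of a zero `z` to `−2R·Im S(T)`: `nestMarginTerm T z := 2R(R − Im z)/‖T − z‖²` (`R = Im T`). -/
def nestMarginTerm (T z : ℂ) : ℝ := 2 * T.im * (T.im - z.im) / Complex.normSq (T - z)

/-- `nestMarginTerm T z = −2R · Im (T − z)⁻¹`. -/
theorem nestMarginTerm_eq (T z : ℂ) : nestMarginTerm T z = -2 * T.im * ((T - z)⁻¹).im := by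
  unfold nestMarginTerm; rw [Complex.inv_im, Complex.sub_im]; ring

/-- `T̄ ↦ 1`: the conjugate of the top contributes EXACTLY the «1» of the margin (the wall `F = (z² + 1)e^{gz}` has `M_T = 0`). -/
theorem nestMarginTerm_conj_self {T : ℂ} (hT : T.im ≠ 0) : nestMarginTerm T (conj T) = 1 := by
  unfold nestMarginTerm
  rw [Complex.normSq_apply, Complex.sub_re, Complex.sub_im, Complex.conj_re, Complex.conj_im]
  have h4 : (T.re - T.re) * (T.re - T.re) + (T.im - -T.im) * (T.im - -T.im) = 4 * T.im ^ 2 := by ring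
  rw [h4]; field_simp; ring

/-- Every zero at height `≤ R` contributes `≥ 0` (a companion's own term, a real zero, a lower pair, any conjugate). -/
theorem nestMarginTerm_nonneg_of_im_le {T z : ℂ} (hT : 0 ≤ T.im) (hz : z.im ≤ T.im) : 0 ≤ nestMarginTerm T z := by
  unfold nestMarginTerm
  exact div_nonneg (mul_nonneg (mul_nonneg (by norm_num) hT) (by linarith)) (Complex.normSq_nonneg _)

/-- A real zero contributes `2R²/‖T − ρ‖² ≥ 0`. -/
theorem nestMarginTerm_ofReal {T : ℂ} (ρ : ℝ) : nestMarginTerm T (ρ : ℂ) = 2 * T.im ^ 2 / Complex.normSq (T - ρ) := by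
  unfold nestMarginTerm; rw [Complex.ofReal_im, sub_zero]; ring

/-- ★ A companion's CONJUGATE contributes `≥ 1` IFF the companion lies in `T`'s CLOSED Jensen disc (`= 1` exactly on the arc). -/
theorem one_le_nestMarginTerm_conj_iff {T q : ℂ} (hT : 0 < T.im) (hq : 0 ≤ q.im) :
    1 ≤ nestMarginTerm T (conj q) ↔ (q.re - T.re) ^ 2 + q.im ^ 2 ≤ T.im ^ 2 := by
  unfold nestMarginTerm
  have hpos : 0 < Complex.normSq (T - conj q) := by
    rw [Complex.normSq_apply, Complex.sub_re, Complex.sub_im, Complex.conj_re, Complex.conj_im]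
    nlinarith [sq_nonneg (T.re - q.re)]
  rw [le_div_iff₀ hpos, one_mul, Complex.normSq_apply, Complex.sub_re, Complex.sub_im, Complex.conj_re, Complex.conj_im]
  constructor <;> intro h <;> nlinarith [h]

/-- ★ A TALLER pair `{b, b̄}` contributes `≥ 0` as soon as `(Re b − Re T)² ≥ (Im b)² − R²`. -/
theorem nestMarginTerm_pair_nonneg_of_sq_le {T b : ℂ} (hT : 0 < T.im) (hb : T.im < b.im) (hX : b.im ^ 2 - T.im ^ 2 ≤ (b.re - T.re) ^ 2) :
    0 ≤ nestMarginTerm T b + nestMarginTerm T (conj b) := by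
  unfold nestMarginTerm
  have hu : 0 < b.im - T.im := by linarith
  have h1 : 0 < Complex.normSq (T - b) := by
    rw [Complex.normSq_apply, Complex.sub_re, Complex.sub_im]; nlinarith [sq_nonneg (T.re - b.re)]
  have h2 : 0 < Complex.normSq (T - conj b) := by
    rw [Complex.normSq_apply, Complex.sub_re, Complex.sub_im, Complex.conj_re, Complex.conj_im]; nlinarith [sq_nonneg (T.re - b.re)]
  rw [div_add_div _ _ h1.ne' h2.ne']
  apply div_nonneg _ (mul_pos h1 h2).le
  rw [Complex.normSq_apply, Complex.normSq_apply, Complex.sub_re, Complex.sub_im, Complex.sub_re, Complex.sub_im, Complex.conj_re,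
    Complex.conj_im]
  -- (v − u)(X² − uv) ≥ 0 with u = Im b − R, v = Im b + R, X = Re b − Re T
  have key : 2 * T.im * (T.im - b.im) * ((T.re - b.re) * (T.re - b.re) + (T.im - -b.im) * (T.im - -b.im)) +
      ((T.re - b.re) * (T.re - b.re) + (T.im - b.im) * (T.im - b.im)) * (2 * T.im * (T.im - -b.im)) =
      4 * T.im ^ 2 * ((b.re - T.re) ^ 2 - (b.im ^ 2 - T.im ^ 2)) := by ring
  have hnn : 0 ≤ 4 * T.im ^ 2 * ((b.re - T.re) ^ 2 - (b.im ^ 2 - T.im ^ 2)) := mul_nonneg (by positivity) (by linarith)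
  linarith [key, hnn]

/-- … in particular under `NoTallerToucher`'s separation `R + Im b < |Re T − Re b|`. -/
theorem nestMarginTerm_pair_nonneg_of_noTaller {T b : ℂ} (hT : 0 < T.im) (hb : T.im < b.im) (hsep : T.im + b.im < |T.re - b.re|) :
    0 ≤ nestMarginTerm T b + nestMarginTerm T (conj b) := by
  refine nestMarginTerm_pair_nonneg_of_sq_le hT hb ?_
  have h0 : 0 ≤ T.im + b.im := by linarith
  have h1 : (T.im + b.im) * (T.im + b.im) < (T.re - b.re) * (T.re - b.re) := by
    have := mul_self_lt_mul_self h0 hsep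
    rwa [abs_mul_abs_self] at this
  nlinarith [h1]

-- The tilt / a real-exponential or real-linear Hadamard factor contributes `0` to `Im S`: Mathlib's `Complex.ofReal_im` (cited, not restated).

end RhW08.Lens1CritMargin
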